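import Mathlib
import Summits.Ventures.LatticeQCDFlow.TrivializingMaps.WitnessColumnRP
import HarnessLib

/-!
# THEOREM W′ — the full witness column: odd separations from link reflection positivity

HONEST FRAMING: exact (Metropolis-corrected) sampling algorithms for lattice gauge theory; figures of
merit are autocorrelation/cost numbers at stated couplings and volumes; no continuum-physics claim.

Companion of `WitnessColumnRP` (THEOREM W). Notation as there: torus Wilson measure
`wilsonMeasure ρ β` of Wave 0 (compact `G`, continuous representation `ρ`, `d ≥ 1`, EVEN `L`), a
bounded measurable real observable `X` of the spatial links of the slice `x₀ = 0`, its translates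
`X⁽ᵗ⁾ := timeTranslate t X` and its column `K(t) := sliceCov ρ β X t = ⟨X X⁽ᵗ⁾⟩ - ⟨X⟩⟨X⁽ᵗ⁾⟩`.

WHAT IS PROVED (no `sorry`).
* §1 [any real `β`] `abs_sliceCov_le_sliceCov_zero`: `|K(t)| ≤ K(0)` for every `t` (stationarity
  and `2|ab| ≤ a² + b²`): every covariance of the column is dominated by the variance.
* §2 [`β ≥ 0`] the ODD half of the column from reflection positivity in the hyperplane BETWEEN
  time slices (`θ x₀ = 1 - x₀`; Literature `wilsonExpectation_reflectionPositive_holds`, the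
  Osterwalder–Seiler link reflection, which needs `β ≥ 0`): `timeTranslate_timeReflect`
  (`θ X⁽ᵗ⁾ = X⁽¹⁻ᵗ⁾`), `sliceCov_linkRP_quadratic` (`0 ≤ K(2a-1) + 2t K(a+b-1) + t² K(2b-1)` for
  real `t`, `1 ≤ a, b ≤ L/2`: positivity of `⟨θF · F⟩` for `F = (X - ⟨X⟩)⁽ᵃ⁾ + t (X - ⟨X⟩)⁽ᵇ⁾`,
  expanded by translation invariance), hence `sliceCov_odd_nonneg`: `0 ≤ K(2a-1)` and
  `sliceCov_sq_le_odd`: `K(a+b-1)² ≤ K(2a-1) K(2b-1)`.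
* §3 [`β ≥ 0`, both reflections] `sliceCov_nonneg_of_le`: `0 ≤ K(t)` for ALL `t ≤ L`;
  `sliceCov_logConvex`: `K(t+1)² ≤ K(t) K(t+2)` for ALL `t + 2 ≤ L` (even `t`: site reflection,
  THEOREM W; odd `t`: §2); `sliceCov_geometric_lower_one`: `v := K(0) > 0`, `c₁ := K(1) > 0` ⟹
  `v (c₁/v)ᵗ ≤ K(t)` for every `t ≤ L` — the ONE-step effective-mass ray, `m₁ = -log (c₁/v) ≥ 0`.
* §4 `Gauge.sep_le_two_mul_range_of_sliceCov_one` — DOCKING (`G = SU(n)`, `β ≥ 0`, `L` even) to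
  the sharp footprint law exactly as THEOREM W (d), with `(c₂, 2j ≤ L)` replaced by `(c₁, t ≤ L)`:
  mean MH acceptance `≥ acc`, `|X| ≤ C`, `4 (1 - acc) C² < v (c₁/v)ᵗ` ⟹ `sep(t) ≤ 2 r`. READING
  (THEORY-1 §29): the INPUT column is generated by the variance `v` and the nearest-neighbour
  slice covariance `c₁`; with the natural link metric (`sep(t) ≍ min (t, L - t)`) the footprint
  floor reads `2 r ≥ t` for every `t ≤ L/2` with `t < log (v / (4 (1 - acc) C²)) / m₁`.

NOT CLAIMED: `β < 0` in §2–§4; any lower bound on `v`, `c₁` themselves (measured inputs; (O3) of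
THEORY-1 stays open as a theorem); quasi-local maps; continuum/scaling statements.

References: K. Osterwalder, E. Seiler, Ann. Phys. 110 (1978) 440, §2 (both reflections);
E. Seiler, LNP 159 (1982) Thm. 2.2; I. Montvay, G. Münster, *Quantum Fields on a Lattice* (1994)
§3.2.8, §4.2.3 (site and link reflection positivity of the Wilson action; with both, correlations
at arbitrary time distance); M. Lüscher, Commun. Math. Phys. 293 (2010) 899.
-/

noncomputable section

namespace Summit.Ventures.LatticeQCDFlow.TrivializingMaps

open MeasureTheory
open scoped ComplexOrder ComplexConjugate

namespace WitnessColumn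

open Literature.MathematicalPhysics.QuantumFieldTheory

variable {d L : ℕ} [NeZero d] [NeZero L] {G : Type*}

/-! ## §1. Every covariance of the column is dominated by the variance (any real `β`) -/

section Variance

variable [Group G] [TopologicalSpace G] [IsTopologicalGroup G] [CompactSpace G] [MeasurableSpace G]
  [BorelSpace G] {N : ℕ} (ρ : G →* Matrix (Fin N) (Fin N) ℂ)

/-- Products of time translates of a bounded measurable observable are integrable. -/
theorem integrable_timeTranslate_mul (hρ : Continuous ρ) (β : ℝ) {Y : GaugeConfig d L G → ℝ}
    (hYm : Measurable Y) {C : ℝ} (hYb : ∀ U, |Y U| ≤ C) (s s' : ZMod L) :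
    Integrable (fun U => timeTranslate s Y U * timeTranslate s' Y U) (wilsonMeasure ρ β) := by
  haveI := isProbabilityMeasure_wilsonMeasure (d := d) (L := L) ρ hρ β
  exact Scoring.integrable_of_bounded _
    ((measurable_timeTranslate hYm s).mul (measurable_timeTranslate hYm s')) (C := C * C)
    fun U => by
      rw [abs_mul]
      exact mul_le_mul (hYb _) (hYb _) (abs_nonneg _) ((abs_nonneg _).trans (hYb U))

/-- `|⟨Y Y⁽ᵗ⁾⟩| ≤ ⟨Y²⟩` for a bounded measurable observable (stationarity and `2|ab| ≤ a² + b²`). -/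
theorem abs_integral_mul_timeTranslate_le (hρ : Continuous ρ) (β : ℝ) {Y : GaugeConfig d L G → ℝ}
    (hYm : Measurable Y) {C : ℝ} (hYb : ∀ U, |Y U| ≤ C) (t : ZMod L) :
    |∫ U, Y U * timeTranslate t Y U ∂(wilsonMeasure ρ β)| ≤ ∫ U, Y U * Y U ∂(wilsonMeasure ρ β) := by
  have h0 := integrable_timeTranslate_mul ρ hρ β hYm hYb 0 t
  have h1 := integrable_timeTranslate_mul ρ hρ β hYm hYb t t
  have h2 := integrable_timeTranslate_mul ρ hρ β hYm hYb 0 0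
  simp only [timeTranslate_zero] at h0 h1 h2
  have hsq : ∫ U, timeTranslate t Y U * timeTranslate t Y U ∂(wilsonMeasure ρ β)
      = ∫ U, Y U * Y U ∂(wilsonMeasure ρ β) := integral_timeTranslate ρ β (fun W => Y W * Y W) t
  have hP : Integrable (fun U => Y U * Y U + timeTranslate t Y U * timeTranslate t Y U)
      (wilsonMeasure ρ β) := h2.add h1
  have hM : Integrable (fun U => 2 * (Y U * timeTranslate t Y U)) (wilsonMeasure ρ β) :=
    h0.const_mul 2
  have hMn : Integrable (fun U => -(2 * (Y U * timeTranslate t Y U))) (wilsonMeasure ρ β) := hM.neg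
  refine abs_le.mpr ⟨?_, ?_⟩
  · have key := integral_mono hMn hP fun U => by
      show -(2 * (Y U * timeTranslate t Y U)) ≤ Y U * Y U + timeTranslate t Y U * timeTranslate t Y U
      nlinarith [sq_nonneg (Y U + timeTranslate t Y U)]
    rw [integral_neg, integral_const_mul, integral_add h2 h1, hsq] at key
    linarith
  · have key := integral_mono hM hP fun U => by
      show 2 * (Y U * timeTranslate t Y U) ≤ Y U * Y U + timeTranslate t Y U * timeTranslate t Y U
      nlinarith [sq_nonneg (Y U - timeTranslate t Y U)]
    rw [integral_const_mul, integral_add h2 h1, hsq] at key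
    linarith

/-- **`|K(t)| ≤ K(0)`.** The covariance of a bounded measurable observable with any of its time
translates is at most its variance in absolute value; in particular `c₁ = K(1) ≤ v`, `c₂ = K(2) ≤ v`
(`v = K(0)` the variance, `sliceCov_zero`). -/
theorem abs_sliceCov_le_sliceCov_zero (hρ : Continuous ρ) (β : ℝ) {X : GaugeConfig d L G → ℝ}
    (hXm : Measurable X) {C : ℝ} (hXb : ∀ U, |X U| ≤ C) (t : ZMod L) :
    |sliceCov ρ β X t| ≤ sliceCov ρ β X 0 := by
  rw [sliceCov_eq_integral_centred ρ hρ β hXm hXb t, sliceCov_eq_integral_centred ρ hρ β hXm hXb 0,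
    timeTranslate_zero]
  exact abs_integral_mul_timeTranslate_le ρ hρ β (hXm.sub measurable_const)
    (C := C + |∫ V, X V ∂(wilsonMeasure ρ β)|)
    (fun U => (abs_sub _ _).trans (add_le_add (hXb U) le_rfl)) t

end Variance

/-! ## §2. The odd half of the column from link reflection positivity (`β ≥ 0`) -/

section LinkKinematics

variable [MeasurableSpace G]

omit [NeZero L] in
/-- **Reflection identity (link reflection).** The reflection `x₀ ↦ 1 - x₀` in the hyperplane
between the slices `0 | 1` carries the slice-`t` copy of a slice-`0` observable to its
slice-`(1 - t)` copy. -/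
theorem timeTranslate_timeReflect [Group G] {α : Type*} {X : GaugeConfig d L G → α}
    (hX : DependsOn X (sliceEdges d L 0)) (t : ZMod L) (U : GaugeConfig d L G) :
    timeTranslate t X U.timeReflect = timeTranslate (1 - t) X U := by
  refine hX fun e he => ?_
  obtain ⟨h2, h0⟩ := he
  rw [torusConfigShift_neg_apply, torusConfigShift_neg_apply]
  have hL : U.timeReflect (e.1 + Pi.single 0 t, e.2)
      = U ((e.1 + Pi.single 0 t).timeReflect, e.2) := by
    simp only [GaugeConfig.timeReflect, if_neg h2]
  have key : (e.1 + Pi.single 0 t).timeReflect = e.1 + Pi.single 0 (1 - t) := by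
    funext k
    by_cases hk : k = 0
    · subst hk
      rw [WilsonRP.timeReflect_apply_zero, Pi.add_apply, Pi.add_apply, Pi.single_eq_same,
        Pi.single_eq_same, h0, zero_add, zero_add]
    · rw [WilsonRP.timeReflect_apply_of_ne _ hk, Pi.add_apply, Pi.add_apply, Pi.single_eq_of_ne hk,
        Pi.single_eq_of_ne hk]
  rw [hL, key]

omit [MeasurableSpace G] in
/-- The spatial links of a slice `x₀ = c` with `1 ≤ c ≤ L/2` lie in the positive-time half
`Λ₊ = {1 ≤ x₀ ≤ L/2}` of the link reflection. -/
theorem sliceEdges_subset_pos {c : ℕ} (hc1 : 1 ≤ c) (hc : c ≤ L / 2) :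
    ∀ e ∈ sliceEdges d L (c : ZMod L), e.2 ≠ 0 ∧ 1 ≤ (e.1 0).val ∧ (e.1 0).val ≤ L / 2 := by
  intro e he
  obtain ⟨h2, h0⟩ := he
  have hcL : c < L := by have := Nat.div_le_self L 2; have := NeZero.ne L; omega
  have hval : (e.1 0).val = c := by rw [h0, ZMod.val_natCast, Nat.mod_eq_of_lt hcL]
  rw [hval]
  exact ⟨h2, hc1, hc⟩

omit [NeZero L] [MeasurableSpace G] in
/-- An observable of links of `Λ₊` (spatial links with `1 ≤ x₀ ≤ L/2`) is a positive-time
observable in the sense of Wave 0 (`IsPositiveTimeObservable`). -/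
theorem isPositiveTimeObservable_of_dependsOn {α : Type*} {Y : GaugeConfig d L G → α}
    {S : Set (Edge d L)} (hY : DependsOn Y S)
    (hS : ∀ e ∈ S, e.2 ≠ 0 ∧ 1 ≤ (e.1 0).val ∧ (e.1 0).val ≤ L / 2) :
    IsPositiveTimeObservable Y := by
  intro U V hUV
  refine hY fun e he => ?_
  obtain ⟨h2, h1, h3⟩ := hS e he
  have hs : (e.1.shift e.2) 0 = e.1 0 := WilsonRP.shift_apply_of_ne _ h2.symm
  exact hUV e h1 h3 (by rw [hs]; exact h1) (by rw [hs]; exact h3)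

end LinkKinematics

section LinkColumn

variable [Group G] [TopologicalSpace G] [IsTopologicalGroup G] [CompactSpace G] [MeasurableSpace G]
  [BorelSpace G] {N : ℕ} (ρ : G →* Matrix (Fin N) (Fin N) ℂ)

/-- **Link-RP quadratic form on slice observables (raw).** For a bounded measurable slice-`0`
observable `Y`, `β ≥ 0`, `L` even, `1 ≤ a, b ≤ L/2` and real `t`: reflection positivity of
`F = Y⁽ᵃ⁾ + t Y⁽ᵇ⁾` (an observable of `Λ₊`) reads, after `θ Y⁽ᶜ⁾ = Y⁽¹⁻ᶜ⁾` and translation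
invariance, `0 ≤ ⟨Y Y⁽²ᵃ⁻¹⁾⟩ + 2t ⟨Y Y⁽ᵃ⁺ᵇ⁻¹⁾⟩ + t² ⟨Y Y⁽²ᵇ⁻¹⁾⟩`. -/
theorem integral_linkRP_quadratic_nonneg (hL : Even L) (hρ : Continuous ρ) {β : ℝ} (hβ : 0 ≤ β)
    {Y : GaugeConfig d L G → ℝ} (hYm : Measurable Y) {C : ℝ} (hYb : ∀ U, |Y U| ≤ C)
    (hY : DependsOn Y (sliceEdges d L 0)) {a b : ℕ} (ha1 : 1 ≤ a) (ha : a ≤ L / 2) (hb1 : 1 ≤ b)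
    (hb : b ≤ L / 2) (t : ℝ) :
    0 ≤ (∫ U, Y U * timeTranslate ((2 * a - 1 : ℕ) : ZMod L) Y U ∂(wilsonMeasure ρ β))
        + 2 * (∫ U, Y U * timeTranslate ((a + b - 1 : ℕ) : ZMod L) Y U ∂(wilsonMeasure ρ β)) * t
        + (∫ U, Y U * timeTranslate ((2 * b - 1 : ℕ) : ZMod L) Y U ∂(wilsonMeasure ρ β)) * t ^ 2 := by
  haveI := isProbabilityMeasure_wilsonMeasure (d := d) (L := L) ρ hρ β
  -- the test observable `F = Y⁽ᵃ⁾ + t Y⁽ᵇ⁾` (complexified) is a bounded measurable observable of `Λ₊`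
  have hFm : Measurable fun U => ((timeTranslate (a : ZMod L) Y U
      + t * timeTranslate (b : ZMod L) Y U : ℝ) : ℂ) :=
    Complex.measurable_ofReal.comp
      ((measurable_timeTranslate hYm _).add ((measurable_timeTranslate hYm _).const_mul t))
  have hFb : ∃ C' : ℝ, ∀ U, ‖((timeTranslate (a : ZMod L) Y U
      + t * timeTranslate (b : ZMod L) Y U : ℝ) : ℂ)‖ ≤ C' :=
    ⟨C + |t| * C, fun U => by
      rw [Complex.norm_real, Real.norm_eq_abs]
      refine (abs_add_le _ _).trans (add_le_add (hYb _) ?_)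
      rw [abs_mul]
      exact mul_le_mul_of_nonneg_left (hYb _) (abs_nonneg t)⟩
  have hFpos : IsPositiveTimeObservable fun U => ((timeTranslate (a : ZMod L) Y U
      + t * timeTranslate (b : ZMod L) Y U : ℝ) : ℂ) := by
    intro U V hUV
    have hag : ∀ {c : ℕ}, 1 ≤ c → c ≤ L / 2 →
        timeTranslate (c : ZMod L) Y U = timeTranslate (c : ZMod L) Y V :=
      fun hc1 hc => isPositiveTimeObservable_of_dependsOn (dependsOn_timeTranslate hY _)
        (sliceEdges_subset_pos hc1 hc) U V hUV
    show ((timeTranslate (a : ZMod L) Y U + t * timeTranslate (b : ZMod L) Y U : ℝ) : ℂ)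
      = ((timeTranslate (a : ZMod L) Y V + t * timeTranslate (b : ZMod L) Y V : ℝ) : ℂ)
    rw [hag ha1 ha, hag hb1 hb]
  have hRP := (wilsonExpectation_reflectionPositive_holds (d := d) (L := L) (ρ := ρ))
    hL hρ hβ _ hFm hFb hFpos
  simp only [wilsonExpectation, timeTranslate_timeReflect hY, Complex.conj_ofReal,
    ← Complex.ofReal_mul] at hRP
  rw [integral_complex_ofReal, Complex.zero_le_real] at hRP
  have hI := integrable_timeTranslate_mul ρ hρ β hYm hYb
  have hI2 : Integrable (fun U => t * (timeTranslate (1 - (a : ZMod L)) Y U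
      * timeTranslate (b : ZMod L) Y U + timeTranslate (1 - (b : ZMod L)) Y U
      * timeTranslate (a : ZMod L) Y U)) (wilsonMeasure ρ β) := ((hI _ _).add (hI _ _)).const_mul t
  have hI3 : Integrable (fun U => t ^ 2 * (timeTranslate (1 - (b : ZMod L)) Y U
      * timeTranslate (b : ZMod L) Y U)) (wilsonMeasure ρ β) := (hI _ _).const_mul _
  have hI23 : Integrable (fun U => t * (timeTranslate (1 - (a : ZMod L)) Y U
      * timeTranslate (b : ZMod L) Y U + timeTranslate (1 - (b : ZMod L)) Y U
      * timeTranslate (a : ZMod L) Y U) + t ^ 2 * (timeTranslate (1 - (b : ZMod L)) Y U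
      * timeTranslate (b : ZMod L) Y U)) (wilsonMeasure ρ β) := hI2.add hI3
  -- translation invariance: `⟨Y⁽¹⁻ᶜ⁾ Y⁽ᵉ⁾⟩ = ⟨Y Y⁽ᶜ⁺ᵉ⁻¹⁾⟩`
  have hR : ∀ c e : ℕ, 1 ≤ c →
      ∫ U, timeTranslate (1 - (c : ZMod L)) Y U * timeTranslate (e : ZMod L) Y U ∂(wilsonMeasure ρ β)
        = ∫ U, Y U * timeTranslate ((c + e - 1 : ℕ) : ZMod L) Y U ∂(wilsonMeasure ρ β) := by
    intro c e hc
    have h1 : (1 - (c : ZMod L)) = -((c : ZMod L) - 1) := by ring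
    have h2 : ((c + e - 1 : ℕ) : ZMod L) = (c : ZMod L) - 1 + e := by
      rw [Nat.cast_sub (by omega : 1 ≤ c + e)]; push_cast; ring
    rw [h1, integral_timeTranslate_neg_mul ρ β Y, h2]
  have e : ∀ U, (timeTranslate (1 - (a : ZMod L)) Y U + t * timeTranslate (1 - (b : ZMod L)) Y U)
        * (timeTranslate (a : ZMod L) Y U + t * timeTranslate (b : ZMod L) Y U)
      = timeTranslate (1 - (a : ZMod L)) Y U * timeTranslate (a : ZMod L) Y U
        + (t * (timeTranslate (1 - (a : ZMod L)) Y U * timeTranslate (b : ZMod L) Y U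
            + timeTranslate (1 - (b : ZMod L)) Y U * timeTranslate (a : ZMod L) Y U)
          + t ^ 2 * (timeTranslate (1 - (b : ZMod L)) Y U * timeTranslate (b : ZMod L) Y U)) :=
    fun U => by ring
  simp_rw [e] at hRP
  rw [integral_add (hI _ _) hI23, integral_add hI2 hI3, integral_const_mul, integral_const_mul,
    integral_add (hI _ _) (hI _ _),
    hR a a ha1, hR a b ha1, hR b a hb1, hR b b hb1,
    show b + a - 1 = a + b - 1 by omega, show a + a - 1 = 2 * a - 1 by omega,
    show b + b - 1 = 2 * b - 1 by omega] at hRP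
  linarith [hRP]

/-- **Link-RP quadratic form of the column.** For slice-`0` `X` (bounded measurable), `β ≥ 0`,
`L` even, `1 ≤ a, b ≤ L/2` and every real `t`: `0 ≤ K(2a-1) + 2t K(a+b-1) + t² K(2b-1)`
(§2 raw form applied to the centred observable `X - ⟨X⟩`). -/
theorem sliceCov_linkRP_quadratic (hL : Even L) (hρ : Continuous ρ) {β : ℝ} (hβ : 0 ≤ β)
    {X : GaugeConfig d L G → ℝ} (hXm : Measurable X) {C : ℝ} (hXb : ∀ U, |X U| ≤ C)
    (hX : DependsOn X (sliceEdges d L 0)) {a b : ℕ} (ha1 : 1 ≤ a) (ha : a ≤ L / 2) (hb1 : 1 ≤ b)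
    (hb : b ≤ L / 2) (t : ℝ) :
    0 ≤ sliceCov ρ β X ((2 * a - 1 : ℕ) : ZMod L)
        + 2 * sliceCov ρ β X ((a + b - 1 : ℕ) : ZMod L) * t
        + sliceCov ρ β X ((2 * b - 1 : ℕ) : ZMod L) * t ^ 2 := by
  rw [sliceCov_eq_integral_centred ρ hρ β hXm hXb, sliceCov_eq_integral_centred ρ hρ β hXm hXb,
    sliceCov_eq_integral_centred ρ hρ β hXm hXb]
  exact integral_linkRP_quadratic_nonneg ρ hL hρ hβ (hXm.sub measurable_const)
    (C := C + |∫ V, X V ∂(wilsonMeasure ρ β)|)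
    (fun U => (abs_sub _ _).trans (add_le_add (hXb U) le_rfl)) (dependsOn_sub_const hX _)
    ha1 ha hb1 hb t

/-- **THEOREM W′ (a) — positivity of the odd column** (`β ≥ 0`, `L` even, `1 ≤ a ≤ L/2`):
`0 ≤ K(2a-1) = ⟨X X⁽²ᵃ⁻¹⁾⟩ - ⟨X⟩²`. [link reflection positivity, Osterwalder–Seiler 1978 §2] -/
theorem sliceCov_odd_nonneg (hL : Even L) (hρ : Continuous ρ) {β : ℝ} (hβ : 0 ≤ β)
    {X : GaugeConfig d L G → ℝ} (hXm : Measurable X) {C : ℝ} (hXb : ∀ U, |X U| ≤ C)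
    (hX : DependsOn X (sliceEdges d L 0)) {a : ℕ} (ha1 : 1 ≤ a) (ha : a ≤ L / 2) :
    0 ≤ sliceCov ρ β X ((2 * a - 1 : ℕ) : ZMod L) := by
  have h := sliceCov_linkRP_quadratic ρ hL hρ hβ hXm hXb hX ha1 ha ha1 ha 0
  simpa using h

/-- **THEOREM W′ (b) — the odd Gram inequality** (`β ≥ 0`, `L` even, `1 ≤ a, b ≤ L/2`):
`K(a+b-1)² ≤ K(2a-1) · K(2b-1)`. [Cauchy–Schwarz from link-RP positivity of `F₁ + t F₂`] -/
theorem sliceCov_sq_le_odd (hL : Even L) (hρ : Continuous ρ) {β : ℝ} (hβ : 0 ≤ β)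
    {X : GaugeConfig d L G → ℝ} (hXm : Measurable X) {C : ℝ} (hXb : ∀ U, |X U| ≤ C)
    (hX : DependsOn X (sliceEdges d L 0)) {a b : ℕ} (ha1 : 1 ≤ a) (ha : a ≤ L / 2) (hb1 : 1 ≤ b)
    (hb : b ≤ L / 2) :
    sliceCov ρ β X ((a + b - 1 : ℕ) : ZMod L) ^ 2
      ≤ sliceCov ρ β X ((2 * a - 1 : ℕ) : ZMod L) * sliceCov ρ β X ((2 * b - 1 : ℕ) : ZMod L) := by
  have hq := fun t => sliceCov_linkRP_quadratic ρ hL hρ hβ hXm hXb hX ha1 ha hb1 hb t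
  have hdisc := discrim_le_zero (K := ℝ) (a := sliceCov ρ β X ((2 * b - 1 : ℕ) : ZMod L))
    (b := 2 * sliceCov ρ β X ((a + b - 1 : ℕ) : ZMod L))
    (c := sliceCov ρ β X ((2 * a - 1 : ℕ) : ZMod L)) fun t => (hq t).trans_eq (by ring)
  rw [discrim] at hdisc; nlinarith [hdisc]

/-! ## §3. Both reflections: the whole column is non-negative and log-convex (`β ≥ 0`) -/

/-- **THEOREM W′ (c) — positivity of the whole column** (`β ≥ 0`, `L` even): `0 ≤ K(t)` for every
`t ≤ L` (even `t` from THEOREM W (a), odd `t` from (a) above). -/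
theorem sliceCov_nonneg_of_le (hL : Even L) (hρ : Continuous ρ) {β : ℝ} (hβ : 0 ≤ β)
    {X : GaugeConfig d L G → ℝ} (hXm : Measurable X) {C : ℝ} (hXb : ∀ U, |X U| ≤ C)
    (hX : DependsOn X (sliceEdges d L 0)) {t : ℕ} (ht : t ≤ L) : 0 ≤ sliceCov ρ β X (t : ZMod L) := by
  rcases Nat.even_or_odd t with ⟨s, rfl⟩ | ⟨s, rfl⟩
  · rw [show s + s = 2 * s by ring]
    exact sliceCov_even_nonneg ρ hL hρ β hXm hXb hX (by omega)
  · obtain ⟨k, hk⟩ := hL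
    rw [show 2 * s + 1 = 2 * (s + 1) - 1 by omega]
    exact sliceCov_odd_nonneg ρ ⟨k, hk⟩ hρ hβ hXm hXb hX (by omega) (by omega)

/-- **THEOREM W′ (d) — log-convexity of the whole column** (`β ≥ 0`, `L` even):
`K(t+1)² ≤ K(t) · K(t+2)` for every `t + 2 ≤ L` (even `t`: site reflection, THEOREM W (b) with
`(a, b) = (t/2, t/2 + 1)`; odd `t`: link reflection, (b) above with `(a, b) = ((t+1)/2, (t+3)/2)`). -/
theorem sliceCov_logConvex (hL : Even L) (hρ : Continuous ρ) {β : ℝ} (hβ : 0 ≤ β)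
    {X : GaugeConfig d L G → ℝ} (hXm : Measurable X) {C : ℝ} (hXb : ∀ U, |X U| ≤ C)
    (hX : DependsOn X (sliceEdges d L 0)) {t : ℕ} (ht : t + 2 ≤ L) :
    sliceCov ρ β X ((t + 1 : ℕ) : ZMod L) ^ 2
      ≤ sliceCov ρ β X (t : ZMod L) * sliceCov ρ β X ((t + 2 : ℕ) : ZMod L) := by
  rcases Nat.even_or_odd t with ⟨s, rfl⟩ | ⟨s, rfl⟩
  · have h := sliceCov_sq_le ρ hL hρ β hXm hXb hX (a := s) (b := s + 1) (by omega) (by omega)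
    rwa [show 2 * s = s + s by ring, show 2 * (s + 1) = s + s + 2 by ring] at h
  · obtain ⟨k, hk⟩ := hL
    have h := sliceCov_sq_le_odd ρ ⟨k, hk⟩ hρ hβ hXm hXb hX (a := s + 1) (b := s + 2) (by omega)
      (by omega) (by omega) (by omega)
    rwa [show s + 1 + (s + 2) - 1 = 2 * s + 1 + 1 by omega, show 2 * (s + 1) - 1 = 2 * s + 1 by omega,
      show 2 * (s + 2) - 1 = 2 * s + 1 + 2 by omega] at h

/-- **THEOREM W′ (e) — the one-step geometric lower envelope of the column.** For `β ≥ 0`, `L`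
even: if `v := K(0) > 0` and `c₁ := K(1) > 0` then `v · (c₁ / v)ᵗ ≤ K(t)` for every `t ≤ L` — the
column lies ABOVE the one-step effective-mass ray (`m₁ = -log (c₁/v) ≥ 0` by §1). -/
theorem sliceCov_geometric_lower_one (hL : Even L) (hρ : Continuous ρ) {β : ℝ} (hβ : 0 ≤ β)
    {X : GaugeConfig d L G → ℝ} (hXm : Measurable X) {C : ℝ} (hXb : ∀ U, |X U| ≤ C)
    (hX : DependsOn X (sliceEdges d L 0)) (hv : 0 < sliceCov ρ β X 0) (hc : 0 < sliceCov ρ β X 1)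
    {t : ℕ} (ht : t ≤ L) :
    sliceCov ρ β X 0 * (sliceCov ρ β X 1 / sliceCov ρ β X 0) ^ t ≤ sliceCov ρ β X (t : ZMod L) := by
  set g : ℕ → ℝ := fun i => sliceCov ρ β X (i : ZMod L) with hg
  have e0 : g 0 = sliceCov ρ β X 0 := by simp [hg]
  have e1 : g 1 = sliceCov ρ β X 1 := by simp [hg]
  have hnn : ∀ i, i ≤ L → 0 ≤ g i := fun i hi => sliceCov_nonneg_of_le ρ hL hρ hβ hXm hXb hX hi
  have hconv : ∀ i, i + 2 ≤ L → g (i + 1) ^ 2 ≤ g i * g (i + 2) := fun i hi =>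
    sliceCov_logConvex ρ hL hρ hβ hXm hXb hX hi
  have h := mul_pow_le_of_logConvex hnn hconv (e0 ▸ hv) (e1 ▸ hc) t ht
  rwa [e0, e1] at h

end LinkColumn

/-! ## §4. Docking: the footprint floor from the variance and the nearest-neighbour covariance -/

namespace Gauge

open Literature.MathematicalPhysics.QuantumFieldTheory.Luscher2010

variable {d L n N : ℕ} [NeZero d] [NeZero L]

/-- **THEOREM W′ (f) — footprint floor from `v` and `c₁`** (lattice `SU(n)`, `β ≥ 0`, `L` even,
any `d`, `n`, `ρ`): `π = 𝒵⁻¹ e^{-β S_W} D[U]`, `Φ_* ν` a proposal law (density `q`, `Φ(·)(e)` reads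
only links within `dist`-distance `r` of `e`, mean MH acceptance `≥ acc`); `X` a measurable
slice-`0` observable, `|X| ≤ C`, `v = sliceCov 0 > 0`, `c₁ = sliceCov 1 > 0`. If for some `t ≤ L`
the slices `0`, `t` are `sep`-separated in `dist` and `4 (1 - acc) C² < v (c₁ / v)ᵗ`, then
`sep ≤ 2 r` (witnesses `X`, `X⁽ᵗ⁾`; sign and size of their covariance from THEOREM W′ (e)). -/
theorem sep_le_two_mul_range_of_sliceCov_one (hL : Even L)
    (ρ : Matrix.specialUnitaryGroup (Fin n) ℂ →* Matrix (Fin N) (Fin N) ℂ) (hρ : Continuous ρ)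
    {β : ℝ} (hβ : 0 ≤ β) (dist : Edge d L → Edge d L → ℕ) (hsymm : ∀ e e', dist e e' = dist e' e)
    (htri : ∀ e e' e'', dist e e'' ≤ dist e e' + dist e' e'')
    {Φ : GaugeConfig d L (Matrix.specialUnitaryGroup (Fin n) ℂ) →
      GaugeConfig d L (Matrix.specialUnitaryGroup (Fin n) ℂ)} (hΦm : Measurable Φ)
    {q : GaugeConfig d L (Matrix.specialUnitaryGroup (Fin n) ℂ) → ℝ} (hq0 : ∀ U, 0 ≤ q U) (hqm : Measurable q)
    (hν : (trivialMeasure (Matrix.specialUnitaryGroup (Fin n) ℂ) d L).map Φ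
      = (trivialMeasure (Matrix.specialUnitaryGroup (Fin n) ℂ) d L).withDensity
          fun U => ENNReal.ofReal (q U))
    {Nb : Edge d L → Set (Edge d L)} (hΦ : ∀ e, DependsOn (fun W => Φ W e) (Nb e)) {r : ℕ}
    (hN : ∀ e, ∀ e' ∈ Nb e, dist e e' ≤ r) {acc : ℝ}
    (hacc : acc ≤ ∫ U, ∫ U', min
        (Real.exp (-(β * wilsonAction ρ U)) / (partitionFn fun W :
          GaugeConfig d L (Matrix.specialUnitaryGroup (Fin n) ℂ) => β * wilsonAction ρ W).toReal * q U')
        (Real.exp (-(β * wilsonAction ρ U')) / (partitionFn fun W :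
          GaugeConfig d L (Matrix.specialUnitaryGroup (Fin n) ℂ) => β * wilsonAction ρ W).toReal * q U)
        ∂(trivialMeasure (Matrix.specialUnitaryGroup (Fin n) ℂ) d L)
        ∂(trivialMeasure (Matrix.specialUnitaryGroup (Fin n) ℂ) d L))
    {X : GaugeConfig d L (Matrix.specialUnitaryGroup (Fin n) ℂ) → ℝ} (hXm : Measurable X) {C : ℝ}
    (hXb : ∀ U, |X U| ≤ C) (hX : DependsOn X (sliceEdges d L 0))
    (hv : 0 < sliceCov ρ β X 0) (hc : 0 < sliceCov ρ β X 1) {t : ℕ} (ht : t ≤ L) {sep : ℕ}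
    (hfar : ∀ e ∈ sliceEdges d L 0, ∀ e' ∈ sliceEdges d L (t : ZMod L), sep ≤ dist e e')
    (hacc_t : 4 * (1 - acc) * (C * C)
      < sliceCov ρ β X 0 * (sliceCov ρ β X 1 / sliceCov ρ β X 0) ^ t) :
    sep ≤ 2 * r := by
  have hS : Continuous fun U : GaugeConfig d L (Matrix.specialUnitaryGroup (Fin n) ℂ) =>
      β * wilsonAction ρ U := continuous_const.mul (continuous_wilsonAction_of_continuous ρ hρ)
  have hπ : boltzmannMeasure (fun U : GaugeConfig d L (Matrix.specialUnitaryGroup (Fin n) ℂ) =>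
      β * wilsonAction ρ U) = wilsonMeasure ρ β := Runbook.boltzmannMeasure_wilson_eq ρ β
  refine Gauge.sep_le_two_mul_range_of_meanAccept_four hS dist hsymm htri hΦm hq0 hqm hν hΦ hN hacc
    hXm (measurable_timeTranslate hXm _) hXb (fun U => hXb _) hX (dependsOn_timeTranslate hX _) hfar
    (m := sliceCov ρ β X 0 * (sliceCov ρ β X 1 / sliceCov ρ β X 0) ^ t) ?_ hacc_t
  rw [hπ]
  exact (sliceCov_geometric_lower_one ρ hL hρ hβ hXm hXb hX hv hc ht).trans (le_abs_self _)

end Gauge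

end WitnessColumn

end Summit.Ventures.LatticeQCDFlow.TrivializingMaps

end
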